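import Summits.Ventures.HSemireg.WedgeHankelRecurrenceGaussChebyshevGaussianFibonacci
import Mathlib.NumberTheory.PellMatiyasevic

/-!
# Venture HSemireg — **MATIYASEVIČ'S PELL SEQUENCES ARE CHEBYSHEV VALUES: for `a > 1` and Mathlib's `Pell.xn ∕ Pell.yn` (the solutions of `x² − (a² − 1)y² = 1`), in every commutative ring
# `T_n(a) = x_n`, `U_{n−1}(a) = y_n`, `C_n(2a) = 2x_n`, `S_{n−1}(2a) = y_n`; hence every natural solution of `x² − (a² − 1)y² = 1` is `(T_n(a), U_{n−1}(a))` (Mathlib `Pell.eq_pell`), and the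
# subsequence laws `x_{nk} = x_k(x_n)` (`T_{nk} = T_k ∘ T_n`), `y_{n(k+1)} = y_n · U_k(x_n)`**

HONEST FRAMING. Part of the Lean index of the computation cell `pub-hsemireg` (seat p10 gen 49, Sunday typer «UNIFORM-IN-n»).  Polynomial algebra over a commutative ring (Mathlib
`Polynomial.Chebyshev.T ∕ U ∕ C ∕ S`) and Mathlib's `Mathlib.NumberTheory.PellMatiyasevic` sequences; no variety, no cohomology theory, no sheaf, no Ext group and no semiregularity map is constructed
here; nothing here says that HC / HC_CM / HC_AV holds; no Literature fact (unproved `Prop`) is declared or used.  Custodian versions as in `WedgeHankelSiegelIdeal` (1/3).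
SOURCES (cited).  Yu. V. Matiyasevič, *Enumerable sets are Diophantine*, Dokl. Akad. Nauk SSSR 191 (1970) 279–282, and M. Davis, *Hilbert's tenth problem is unsolvable*, Amer. Math. Monthly 80 (1973)
233–269, §2 (the sequences `x_n(a)`, `y_n(a)` with `x_{n+2} = 2a x_{n+1} − x_n`); T. J. Rivlin, *The Chebyshev Polynomials* (Wiley 1974), §1.2 and Ex. 1.2.15 (`T_n² − (x² − 1)U_{n−1}² = 1`,
`T_{mn} = T_m ∘ T_n`); H. W. Lenstra Jr., *Solving the Pell equation*, Notices AMS 49 (2002) 182–192.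
PROOF TYPED HERE.  (1) Both sides satisfy `a_{n+2} = 2a·a_{n+1} − a_n` (Mathlib `T_add_two ∕ U_add_two` at `X = a`, `Pell.xn_succ_succ ∕ yn_succ_succ`) with the same two initial values
(`T_0(a) = 1 = x_0`, `T_1(a) = a = x_1`; `U_0 = 1 = y_1`, `U_1(a) = 2a = y_2`): two-step induction; `C_n(2X) = 2T_n(X)`, `S_n(2X) = U_n(X)` (Mathlib `C_comp_two_mul_X`, `S_comp_two_mul_X`);
(2) Mathlib `Pell.eq_pell`; (3) `T_{kn} = T_k ∘ T_n` (Mathlib `T_mul`) and N487-type nesting `U_{k(n+1)−1} = U_{k−1}(T_{n+1})·U_n` (this chapter's `chebyshevU_mul_pred_eq_comp`, §1203), read in `ℤ`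
and pulled back to `ℕ` by `Nat.cast_injective`.
DEDUP DISCLOSURE (`rg -ln 'Pell\\.xn|PellMatiyasevic' Summits Literature` — only ABC-summit files, none mentioning Chebyshev; `lean search 'xn_succ_succ'`, 2026-09-04): Mathlib's
`NumberTheory.PellMatiyasevic` and `NumberTheory.Pell` never mention `Polynomial.Chebyshev`, and this chapter's §1208 `WedgeHankelRecurrenceGaussChebyshevPell` types the POLYNOMIAL Pell identity
`T_n² − (X² − 1)U_{n−1}² = 1` only; the identification `x_n = T_n(a)`, `y_n = U_{n−1}(a)` and the composition law for `Pell.xn` are not typed; 0 hits for the 9 names below.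

WHAT IS IN THE TREE.  §1203 `chebyshevU_mul_pred_eq_comp`; Mathlib `T_zero ∕ T_one ∕ T_add_two ∕ U_zero ∕ U_one ∕ U_add_two ∕ U_neg_one`, `T_mul`, `C_comp_two_mul_X`, `S_comp_two_mul_X`, `Pell.xn_zero ∕
xn_one ∕ yn_zero ∕ yn_one ∕ yn_succ ∕ xn_succ_succ ∕ yn_succ_succ ∕ eq_pell`.
THIS FILE (namespace `Summit.Ventures.HSemireg.Wedge.HankelOuter` continued; CHAINED on N527; 0 definitions):
* §1293 **`chebyshevT_eval_eq_pell_xn`** (`T_n(a) = x_n`), **`chebyshevU_eval_eq_pell_yn`** (`U_n(a) = y_{n+1}`), `chebyshevU_pred_eval_eq_pell_yn` (`U_{n−1}(a) = y_n`, `n ∈ ℕ`),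
  **`chebyshevC_eval_eq_two_mul_pell_xn`** (`C_n(2a) = 2x_n`), **`chebyshevS_eval_eq_pell_yn`** (`S_n(2a) = y_{n+1}`), **`pell_solution_eq_chebyshev_eval`** (every solution is
  `(T_n(a), U_{n−1}(a))`), **`pell_xn_mul`** (`x_{nk}(a) = x_k(x_n(a))`), **`pell_yn_mul`** (`y_{n(k+1)}(a) = y_n(a)·U_k(x_n(a))`), `pell_yn_dvd_yn_mul` (`y_n ∣ y_{nk}`, re-derived).
CAVEATS.  `a > 1` throughout (Mathlib's standing hypothesis `a1 : 1 < a`); Mathlib's private `Pell.d a1` is spelled out as `a·a − 1`.  Nothing Ext-side.  New names only.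
-/

open Module Polynomial
open scoped Matrix Polynomial

namespace Summit.Ventures.HSemireg.Wedge.HankelOuter

/-! ## §1293. `Pell.xn a1 n = T_n(a)`, `Pell.yn a1 n = U_{n−1}(a)` -/

/-- **`T_n(a) = x_n(a)`** (Matiyasevič's Pell `x`-sequence, Mathlib `Pell.xn`), in every commutative ring. [Davis 1973, §2; Rivlin 1974, §1.2; this file, §1293] -/
theorem chebyshevT_eval_eq_pell_xn {R : Type*} [CommRing R] {a : ℕ} (a1 : 1 < a) (n : ℕ) :
    (Polynomial.Chebyshev.T R (n : ℤ)).eval (a : R) = (Pell.xn a1 n : R) := by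
  induction n using Nat.twoStepInduction with
  | zero => simp
  | one => simp
  | more n ih0 ih1 =>
    rw [show ((n + 2 : ℕ) : ℤ) = (n : ℤ) + 2 by push_cast; ring, Polynomial.Chebyshev.T_add_two, show (n : ℤ) + 1 = ((n + 1 : ℕ) : ℤ) by push_cast; ring]
    simp only [eval_sub, eval_mul, eval_ofNat, eval_X]
    rw [ih0, ih1]
    have h := Pell.xn_succ_succ a1 n
    have h' : ((Pell.xn a1 (n + 2) + Pell.xn a1 n : ℕ) : R) = ((2 * a * Pell.xn a1 (n + 1) : ℕ) : R) := by rw [h]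
    push_cast at h'
    linear_combination -h'

/-- **`U_n(a) = y_{n+1}(a)`** (Mathlib `Pell.yn`), in every commutative ring. [Davis 1973, §2; Rivlin 1974, §1.2; this file, §1293] -/
theorem chebyshevU_eval_eq_pell_yn {R : Type*} [CommRing R] {a : ℕ} (a1 : 1 < a) (n : ℕ) :
    (Polynomial.Chebyshev.U R (n : ℤ)).eval (a : R) = (Pell.yn a1 (n + 1) : R) := by
  induction n using Nat.twoStepInduction with
  | zero => simp
  | one => simp [two_mul]
  | more n ih0 ih1 =>
    rw [show ((n + 2 : ℕ) : ℤ) = (n : ℤ) + 2 by push_cast; ring, Polynomial.Chebyshev.U_add_two, show (n : ℤ) + 1 = ((n + 1 : ℕ) : ℤ) by push_cast; ring]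
    simp only [eval_sub, eval_mul, eval_ofNat, eval_X]
    rw [ih0, ih1]
    have h := Pell.yn_succ_succ a1 (n + 1)
    rw [show n + 1 + 2 = n + 2 + 1 by ring] at h
    have h' : ((Pell.yn a1 (n + 2 + 1) + Pell.yn a1 (n + 1) : ℕ) : R) = ((2 * a * Pell.yn a1 (n + 1 + 1) : ℕ) : R) := by rw [h]
    push_cast at h'
    linear_combination -h'

/-- `U_{n−1}(a) = y_n(a)` for every `n ∈ ℕ` (`U_{−1} = 0 = y_0`). [Davis 1973, §2; this file, §1293] -/
theorem chebyshevU_pred_eval_eq_pell_yn {R : Type*} [CommRing R] {a : ℕ} (a1 : 1 < a) (n : ℕ) :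
    (Polynomial.Chebyshev.U R ((n : ℤ) - 1)).eval (a : R) = (Pell.yn a1 n : R) := by
  cases n with
  | zero => simp
  | succ m =>
    rw [show (((m + 1 : ℕ) : ℤ) - 1) = (m : ℤ) by push_cast; ring, chebyshevU_eval_eq_pell_yn a1 m]

/-- **`C_n(2a) = 2x_n(a)`** in every commutative ring (`C_n(2X) = 2T_n(X)`). [this file, §1293] -/
theorem chebyshevC_eval_eq_two_mul_pell_xn {R : Type*} [CommRing R] {a : ℕ} (a1 : 1 < a) (n : ℕ) :
    (Polynomial.Chebyshev.C R (n : ℤ)).eval (2 * (a : R)) = 2 * (Pell.xn a1 n : R) := by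
  have h := congrArg (Polynomial.eval (a : R)) (Polynomial.Chebyshev.C_comp_two_mul_X R (n : ℤ))
  rw [eval_comp, eval_mul, eval_ofNat, eval_X, eval_mul, eval_ofNat, chebyshevT_eval_eq_pell_xn a1] at h
  exact h

/-- **`S_n(2a) = y_{n+1}(a)`** in every commutative ring (`S_n(2X) = U_n(X)`). [this file, §1293] -/
theorem chebyshevS_eval_eq_pell_yn {R : Type*} [CommRing R] {a : ℕ} (a1 : 1 < a) (n : ℕ) :
    (Polynomial.Chebyshev.S R (n : ℤ)).eval (2 * (a : R)) = (Pell.yn a1 (n + 1) : R) := by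
  have h := congrArg (Polynomial.eval (a : R)) (Polynomial.Chebyshev.S_comp_two_mul_X R (n : ℤ))
  rw [eval_comp, eval_mul, eval_ofNat, eval_X, chebyshevU_eval_eq_pell_yn a1] at h
  exact h

/-- **Every natural solution of `x² − (a² − 1)y² = 1` is `(T_n(a), U_{n−1}(a))` for some `n ∈ ℕ`** (Mathlib `Pell.eq_pell` read through `T_n(a) = x_n`, `U_{n−1}(a) = y_n`).
[Lenstra 2002; Davis 1973, §2; this file, §1293] -/
theorem pell_solution_eq_chebyshev_eval {a : ℕ} (a1 : 1 < a) {x y : ℕ} (h : x * x - (a * a - 1) * y * y = 1) :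
    ∃ n : ℕ, (x : ℤ) = (Polynomial.Chebyshev.T ℤ (n : ℤ)).eval (a : ℤ) ∧ (y : ℤ) = (Polynomial.Chebyshev.U ℤ ((n : ℤ) - 1)).eval (a : ℤ) := by
  obtain ⟨n, hx, hy⟩ := Pell.eq_pell a1 h
  exact ⟨n, by rw [hx, chebyshevT_eval_eq_pell_xn a1 n], by rw [hy, chebyshevU_pred_eval_eq_pell_yn a1 n]⟩

/-! ### Subsequence laws through `T_{kn} = T_k ∘ T_n` -/

/-- **`x_{nk}(a) = x_k(x_n(a))`** for `n` with `x_n(a) > 1` (`T_{kn} = T_k ∘ T_n`, Mathlib `T_mul`). [Rivlin 1974, §1.2; Lenstra 2002; this file, §1293] -/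
theorem pell_xn_mul {a : ℕ} (a1 : 1 < a) {n : ℕ} (hn : 1 < Pell.xn a1 n) (k : ℕ) : Pell.xn a1 (n * k) = Pell.xn hn k := by
  have h : ((Pell.xn a1 (n * k) : ℕ) : ℤ) = ((Pell.xn hn k : ℕ) : ℤ) := by
    rw [← chebyshevT_eval_eq_pell_xn a1 (n * k), ← chebyshevT_eval_eq_pell_xn hn k, ← chebyshevT_eval_eq_pell_xn a1 n,
      show ((n * k : ℕ) : ℤ) = (k : ℤ) * (n : ℤ) by push_cast; ring, Polynomial.Chebyshev.T_mul, eval_comp]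
  exact_mod_cast h

/-- **`y_{n(k+1)}(a) = y_n(a) · U_k(x_n(a))`** for `n` with `x_n(a) > 1` (`U_{(k+1)n−1} = U_k(T_n)·U_{n−1}`, §1203), hence `y_n ∣ y_{n(k+1)}`. [Rivlin 1974, Ex. 1.2.15; this file, §1293] -/
theorem pell_yn_mul {a : ℕ} (a1 : 1 < a) {n : ℕ} (hn : 1 < Pell.xn a1 n) (k : ℕ) : Pell.yn a1 (n * (k + 1)) = Pell.yn a1 n * Pell.yn hn (k + 1) := by
  rcases Nat.eq_zero_or_pos n with rfl | hpos
  · simp [Pell.yn_zero]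
  obtain ⟨m, rfl⟩ := Nat.exists_eq_succ_of_ne_zero hpos.ne'
  have h : ((Pell.yn a1 ((m + 1) * (k + 1)) : ℕ) : ℤ) = ((Pell.yn a1 (m + 1) * Pell.yn hn (k + 1) : ℕ) : ℤ) := by
    rw [Nat.cast_mul, ← chebyshevU_pred_eval_eq_pell_yn a1 ((m + 1) * (k + 1)), ← chebyshevU_pred_eval_eq_pell_yn a1 (m + 1), ← chebyshevU_eval_eq_pell_yn hn k,
      ← chebyshevT_eval_eq_pell_xn a1 (m + 1), show ((((m + 1) * (k + 1) : ℕ) : ℤ) - 1) = ((k + 1 : ℕ) : ℤ) * ((m : ℤ) + 1) - 1 by push_cast; ring,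
      chebyshevU_mul_pred_eq_comp (k + 1) (m : ℤ), show (((k + 1 : ℕ) : ℤ) - 1) = (k : ℤ) by push_cast; ring, show (((m + 1 : ℕ) : ℤ) - 1) = (m : ℤ) by push_cast; ring,
      show ((m + 1 : ℕ) : ℤ) = (m : ℤ) + 1 by push_cast; ring, eval_mul, eval_comp]
    ring
  exact_mod_cast h

/-- `y_n(a) ∣ y_{nk}(a)` (Mathlib has this as `Pell.y_dvd_iff`-type statements; re-derived from `pell_yn_mul`). [this file, §1293] -/
theorem pell_yn_dvd_yn_mul {a : ℕ} (a1 : 1 < a) {n : ℕ} (hn : 1 < Pell.xn a1 n) (k : ℕ) : Pell.yn a1 n ∣ Pell.yn a1 (n * k) := by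
  cases k with
  | zero => simp [Pell.yn_zero]
  | succ k => exact ⟨Pell.yn hn (k + 1), pell_yn_mul a1 hn k⟩

end Summit.Ventures.HSemireg.Wedge.HankelOuter
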